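import Summits.CriticalPhenomena.PercolationContinuityZ3.Theorems.Transplant.FKConnectivityAllQPat3ShapeOneCone
import HarnessLib

/-!
# Connectivity correlation inequalities for `φ_{w,q}`, every `q > 0` — ONE-PIECE SHAPES WITH CONTRACTED SKELETON EDGES
# (the `t = 1` engine of census g40 on the minors that contract plain slots; product cone)

Proof file with definitions (`--supports stmt-CriticalPhenomena-4575`), census lineage (gen 41) of LANE 2's FK sub-programme;
builds on p205010 (kernel theorem, internal audit signed; external expert review pending).  No named facts, no sorries.

WHY (census g41, located gap in census g39 §3 / g40 §8): in the `(E, C)`-minor form of census g37 the one-sided two-sum law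
(`…Pat3SlotLaw`: host, host `+ e`, host `/ e`) feeds the recursion for 𝒦-networks minors that CONTRACT a plain skeleton slot `e`
(the third hypothesis), and such a minor of a bridge-topped network is NOT a minor of any network with fewer edges that the tree
can name (the quotient `K₄ − ab ∕ e` is a multigraph on three vertices; `Finset (Sym2 V)` has no parallel edges and no quotient
vertex type).  So every `K₄`-skeleton leaf of census g39 is needed in all `{free, contracted}^{#plain edges}` states, not only the
all-free state of census g40's data.  This file is the `t = 1` engine for those states: the skeleton is a list `L` of FREE plain edges
and a list `K` of CONTRACTED plain edges (always open on both members of the antipodal pair).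
* `FK.trueBits`, `FK.cmat_union_plainSet` (the matrix of `A ∪ plainSet p K` is the `attachBit`-fold of that of `A` with all bits
  true), `FK.clusterCount_union_plainSet` (`k(A ∪ K) + |K| = k(A) + #corrections`), `FK.sum_plainListK_empty` (the whole skeleton,
  free and contracted, from the edgeless host).
* `FK.skelCorrK / skelPatK / shape1TermK`, **`FK.lev2C_shape1K`**: `lev2C (plainSet p L ∪ EQ) (plainSet p K ∪ CQ)` of a skeleton
  `(L, K)` plus ONE marked piece minor `(EQ, CQ; u, v, m)` as `Σ_γ sumBits |L| shape1TermK`.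
The product cone for these shapes (`FK.coefTab1K`, `FK.shape1KC_nonneg_of_cert`) is the sibling `…Pat3ShapeOneKCone.lean`.  With
`K = []` everything is census g40's `…Pat3ShapeOne` verbatim.
[cite: AyyerLinussonRavichandran2025, §7 (p. 22)] [cite: Grimmett2006, §1.4 eq. (1.20) (p. 15)]
-/

namespace Summit.CriticalPhenomena.PercolationContinuityZ3.Theorems

namespace FK

open SimpleGraph Literature.Probability.LatticeModels Literature.Probability.Percolation
open scoped Classical

variable {V : Type*}

section ContractedSkeleton

variable [Fintype V] {ι : Type*} [DecidableEq ι]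

/-- Named edges all decorated with the bit `true` (the contracted skeleton edges: open on both members of the pair). [folklore] -/
def trueBits (K : List (ι × ι)) : List (ι × ι × Bool) := K.map fun e => (e.1, e.2, true)

omit [Fintype V] [DecidableEq ι] in
/-- `trueBits` of a cons (definitional). [folklore] -/
theorem trueBits_cons (i j : ι) (K : List (ι × ι)) : trueBits ((i, j) :: K) = (i, j, true) :: trueBits K := rfl

omit [Fintype V] in
/-- The one-edge configuration joins its own ends (also for a degenerate pair). [folklore] -/
theorem conn_singleton_ends (u v : V) : conn ({s(u, v)} : Finset (Sym2 V)) u v = true := by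
  by_cases huv : u = v
  · subst huv
    exact conn_of_reachable (Reachable.refl _)
  · refine conn_of_reachable (SimpleGraph.Adj.reachable ((openGraph_adj _ u v).2 ⟨?_, huv⟩))
    rw [Finset.coe_singleton]; exact Set.mem_singleton _

omit [Fintype V] [DecidableEq ι] in
/-- Adding one edge between named points to ANY configuration: the matrix becomes `attachBit` with the bit `true`. [folklore] -/
theorem cmat_union_singleton (p : ι → V) (A : Finset (Sym2 V)) (i j : ι) :
    cmat p (A ∪ {s(p i, p j)}) = attachBit (cmat p A) i j true := by
  have hm := cmat_union_eq_attachBit (p := p) (E₁ := A) (E₂ := {s(p i, p j)}) (V₁ := Set.univ) (V₂ := {p i, p j})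
    (fun _ _ _ _ => trivial) (edges_singleton_verts (p i) (p j)) (fun z hz => hz.2) (fun a h => h) rfl rfl
    (subset_refl A) (subset_refl _)
  rwa [conn_singleton_ends] at hm

omit [Fintype V] [DecidableEq ι] in
/-- **Contracted skeleton edges, matrices**: the connectivity matrix of `A ∪ plainSet p K` is the fold of `attachBit` with all bits
`true` over that of `A` (any configuration `A`; `K` may have repeated or already-joined edges). [folklore] -/
theorem cmat_union_plainSet (p : ι → V) (K : List (ι × ι)) (A : Finset (Sym2 V)) :
    cmat p (A ∪ plainSet p K) = (foldBits (cmat p A) (trueBits K)).1 := by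
  induction K generalizing A with
  | nil =>
    have h0 : plainSet p ([] : List (ι × ι)) = (∅ : Finset (Sym2 V)) := rfl
    rw [h0, Finset.union_empty]; rfl
  | cons e K ih =>
    obtain ⟨i, j⟩ := e
    have hA : A ∪ plainSet p ((i, j) :: K) = (A ∪ {s(p i, p j)}) ∪ plainSet p K := by
      rw [plainSet_cons, Finset.insert_eq, Finset.union_assoc]; rfl
    rw [hA, ih, cmat_union_singleton, trueBits_cons, foldBits_cons]

omit [DecidableEq ι] in
/-- **Contracted skeleton edges, cluster count**: `k(A ∪ plainSet p K) + |K| = k(A) + #{edges of K whose ends were already joined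
when their turn came}` (the second component of the fold). [folklore] -/
theorem clusterCount_union_plainSet (p : ι → V) (K : List (ι × ι)) (A : Finset (Sym2 V)) :
    clusterCount (↑(A ∪ plainSet p K) : BondConfig V) ∅ + K.length =
      clusterCount (↑A : BondConfig V) ∅ + (foldBits (cmat p A) (trueBits K)).2 := by
  induction K generalizing A with
  | nil =>
    have h0 : plainSet p ([] : List (ι × ι)) = (∅ : Finset (Sym2 V)) := rfl
    rw [h0, Finset.union_empty]; rfl
  | cons e K ih =>
    obtain ⟨i, j⟩ := e
    have hA : A ∪ plainSet p ((i, j) :: K) = (A ∪ {s(p i, p j)}) ∪ plainSet p K := by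
      rw [plainSet_cons, Finset.insert_eq, Finset.union_assoc]; rfl
    rw [hA, trueBits_cons, foldBits_cons, List.length_cons]
    have ih' := ih (A ∪ {s(p i, p j)})
    rw [cmat_union_singleton] at ih'
    have k := clusterCount_union_pair_add (↑A : BondConfig V) (p i) (p j)
    rw [← Finset.coe_singleton, ← Finset.coe_union] at k
    by_cases hr : (openGraph (↑A : BondConfig V)).Reachable (p i) (p j)
    · rw [if_pos hr] at k
      have hb : (cmat p A i j && true) = true := by rw [Bool.and_true]; exact conn_of_reachable hr
      rw [if_pos hb]
      omega
    · rw [if_neg hr] at k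
      have hb : ¬ ((cmat p A i j && true) = true) := by
        rw [Bool.and_true]; unfold cmat; rw [conn_of_not_reachable hr]; exact Bool.false_ne_true
      rw [if_neg hb]
      omega

omit [DecidableEq ι] in
/-- The contracted exponent of a skeleton `(L free, K contracted)` against its free exponent: `+ 2|K|` = `+` the two correction
counts of the `K`-folds. [folklore] -/
theorem apExpC_plainSet (p : ι → V) (L K : List (ι × ι)) {γ : Finset (Sym2 V)} :
    apExpC (plainSet p L) (plainSet p K) γ + 2 * K.length =
      apExp (plainSet p L) γ + ((foldBits (cmat p γ) (trueBits K)).2 + (foldBits (cmat p (plainSet p L \ γ)) (trueBits K)).2) := by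
  unfold apExpC apExp
  have h1 := clusterCount_union_plainSet p K γ
  have h2 := clusterCount_union_plainSet p K (plainSet p L \ γ)
  omega

/-- **THE WHOLE SKELETON FROM THE EDGELESS HOST, free AND contracted edges**: the configuration sum over the free plain edges `L`
with the contracted plain edges `K` riding along (injective names) is one term per bit list: matrices = the `K`-fold (all bits true)
of the `L`-fold (bits / negated bits) of the identity matrix; level `2|V| +` the four correction counts. [folklore] -/
theorem sum_plainListK_empty {β : Type*} [AddCommMonoid β] {p : ι → V} (hinj : Function.Injective p) (L K : List (ι × ι))
    (hL : ∀ e ∈ L, p e.1 ≠ p e.2) (hnd : (L.map (pedge p)).Nodup)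
    (s₀ : ℕ) (g : ℕ → (ι → ι → Bool) → (ι → ι → Bool) → β) :
    ∑ γ ∈ (plainSet p L).powerset, g (apExpC (plainSet p L) (plainSet p K) γ + 2 * K.length + L.length + s₀)
        (cmat p (γ ∪ plainSet p K)) (cmat p (plainSet p L \ γ ∪ plainSet p K)) =
      sumBits L.length fun bs =>
        g (2 * Fintype.card V + (foldBits (idMat ι) (zipBits L bs)).2 + (foldBits (idMat ι) (zipBits L (bs.map (! ·)))).2 +
              ((foldBits (foldBits (idMat ι) (zipBits L bs)).1 (trueBits K)).2 +
                (foldBits (foldBits (idMat ι) (zipBits L (bs.map (! ·)))).1 (trueBits K)).2) + s₀)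
          (foldBits (foldBits (idMat ι) (zipBits L bs)).1 (trueBits K)).1
          (foldBits (foldBits (idMat ι) (zipBits L (bs.map (! ·)))).1 (trueBits K)).1 := by
  rw [Finset.sum_congr rfl fun γ _ => show g (apExpC (plainSet p L) (plainSet p K) γ + 2 * K.length + L.length + s₀)
        (cmat p (γ ∪ plainSet p K)) (cmat p (plainSet p L \ γ ∪ plainSet p K)) =
      (fun n A B => g (n + ((foldBits A (trueBits K)).2 + (foldBits B (trueBits K)).2))
        (foldBits A (trueBits K)).1 (foldBits B (trueBits K)).1) (apExp (plainSet p L) γ + L.length + s₀)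
        (cmat p γ) (cmat p (plainSet p L \ γ)) by
    simp only [cmat_union_plainSet]
    congr 1
    have e := apExpC_plainSet p L K (γ := γ)
    omega]
  rw [sum_plainList_empty hinj L hL hnd s₀ (fun n A B => g (n + ((foldBits A (trueBits K)).2 + (foldBits B (trueBits K)).2))
        (foldBits A (trueBits K)).1 (foldBits B (trueBits K)).1)]
  congr 1
  funext bs
  show g _ _ _ = g _ _ _
  congr 1
  omega

/-! ### One marked piece on a skeleton with contracted edges -/

/-- **Level corrections of a one-piece shape with contracted skeleton edges** at colouring `bs` and piece patterns `(P, Q)`: the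
cycle-closing free edges, the already-joined contracted edges, and `1{terminals joined ∧ P.xy}`, on both sides. [folklore] -/
def skelCorrK (L K : List (ι × ι)) (i j : ι) (bs : List Bool) (P Q : Pat3) : ℕ :=
  (foldBits (idMat ι) (zipBits L bs)).2 + (foldBits (foldBits (idMat ι) (zipBits L bs)).1 (trueBits K)).2 +
      (if (foldBits (foldBits (idMat ι) (zipBits L bs)).1 (trueBits K)).1 i j && P.xy then 1 else 0) +
    ((foldBits (idMat ι) (zipBits L (bs.map (! ·)))).2 +
        (foldBits (foldBits (idMat ι) (zipBits L (bs.map (! ·)))).1 (trueBits K)).2 +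
      (if (foldBits (foldBits (idMat ι) (zipBits L (bs.map (! ·)))).1 (trueBits K)).1 i j && Q.xy then 1 else 0))

/-- **Composite patterns of a one-piece shape with contracted skeleton edges** (configuration side). [folklore] -/
def skelPatK (L K : List (ι × ι)) (i j k ix iy is : ι) (bs : List Bool) (P : Pat3) : Pat3 :=
  rdPat ix iy is (attachPat (foldBits (foldBits (idMat ι) (zipBits L bs)).1 (trueBits K)).1 i j k P)

/-- **The summand of a one-piece shape with contracted skeleton edges** at colouring `bs`, piece data `(ℓ, P, Q)` and target level
`μ` (`|L| + 2|K|` absorbs the skeleton's own exponents). [folklore] -/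
def shape1TermK (L K : List (ι × ι)) (i j k ix iy is : ι) (F : ℕ → Pat3 → Pat3 → ℤ) (μ : ℕ) (bs : List Bool)
    (ℓ : ℕ) (P Q : Pat3) : ℤ :=
  (if ℓ + skelCorrK L K i j bs P Q = μ + L.length + 2 * K.length then
      F 0 (skelPatK L K i j k ix iy is bs P) (skelPatK L K i j k ix iy is (bs.map (! ·)) Q) else 0) +
    (if ℓ + skelCorrK L K i j bs P Q + 1 = μ + L.length + 2 * K.length then
      F 1 (skelPatK L K i j k ix iy is bs P) (skelPatK L K i j k ix iy is (bs.map (! ·)) Q) else 0)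

variable {p : ι → V} {L K : List (ι × ι)} {EQ : Finset (Sym2 V)} {VQ : Set V} {u v m x y s : V} {i j k ix iy is : ι}

omit [Fintype V] [DecidableEq ι] in
/-- The plain edges of a list on names host-side of a piece live off the piece's interior. [folklore] -/
theorem plainSet_verts (hp : ∀ a, p a ∈ VQ → p a = u ∨ p a = v ∨ p a = m) (hLm : ∀ e ∈ L, p e.1 ≠ m ∧ p e.2 ≠ m) :
    ∀ e ∈ (↑(plainSet p L) : Set (Sym2 V)), ∀ z ∈ e, z ∈ ({z | z ∈ VQ → z = u ∨ z = v} : Set V) := by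
  intro e he z hz hzQ
  rw [Finset.mem_coe] at he
  unfold plainSet at he
  rw [List.mem_toFinset, List.mem_map] at he
  obtain ⟨f, hf, rfl⟩ := he
  have hz' : z = p f.1 ∨ z = p f.2 := Sym2.mem_iff.1 hz
  rcases hz' with rfl | rfl
  · rcases hp f.1 hzQ with h | h | h
    · exact Or.inl h
    · exact Or.inr h
    · exact absurd h (hLm f hf).1
  · rcases hp f.2 hzQ with h | h | h
    · exact Or.inl h
    · exact Or.inr h
    · exact absurd h (hLm f hf).2

/-- **THE TWO-LEVEL VALUE OF A ONE-PIECE SHAPE WITH CONTRACTED SKELETON EDGES, PIECE READ AS A MINOR**: skeleton `L` (free) and `K`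
(contracted) on injective names, one marked piece minor `(EQ, CQ; u, v, m)` on `VQ` glued at the names `i, j` with mark name `k`,
marks read at `ix, iy, is`: `lev2C (plainSet p L ∪ EQ) (plainSet p K ∪ CQ)` at level `μ` is the sum over the piece's configurations
and the free colourings of `FK.shape1TermK` — `FK.sum_attachPatCC` then `FK.sum_plainListK_empty`. [folklore] -/
theorem lev2C_shape1K {CQ : Finset (Sym2 V)} (hinj : Function.Injective p)
    (hQ : ∀ e ∈ (↑(EQ ∪ CQ) : Set (Sym2 V)), ∀ z ∈ e, z ∈ VQ) (huv : u ≠ v)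
    (hmQ : m ∈ VQ) (hmu : m ≠ u) (hmv : m ≠ v) (hp : ∀ a, p a ∈ VQ → p a = u ∨ p a = v ∨ p a = m)
    (hi : p i = u) (hj : p j = v) (hk : p k = m) (hx : p ix = x) (hy : p iy = y) (hs : p is = s)
    (hL : ∀ e ∈ L, p e.1 ≠ p e.2) (hnd : (L.map (pedge p)).Nodup) (hLm : ∀ e ∈ L, p e.1 ≠ m ∧ p e.2 ≠ m)
    (hKm : ∀ e ∈ K, p e.1 ≠ m ∧ p e.2 ≠ m)
    (hdQ : Disjoint (plainSet p L) EQ) (F : ℕ → Pat3 → Pat3 → ℤ) (μ : ℕ) :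
    lev2C (plainSet p L ∪ EQ) (plainSet p K ∪ CQ) x y s F μ =
      ∑ γ ∈ EQ.powerset, sumBits L.length fun bs =>
        shape1TermK L K i j k ix iy is F μ bs (apExpC EQ CQ γ) (pat3 (γ ∪ CQ) u v m) (pat3 (EQ \ γ ∪ CQ) u v m) := by
  -- the host (skeleton, free and contracted) lives off the piece's interior
  have hm : m ∉ ({z | z ∈ VQ → z = u ∨ z = v} : Set V) := fun h => (h hmQ).elim hmu hmv
  have h₁ : ∀ e ∈ (↑(plainSet p L ∪ plainSet p K) : Set (Sym2 V)), ∀ z ∈ e, z ∈ ({z | z ∈ VQ → z = u ∨ z = v} : Set V) := by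
    intro e he z hz
    rw [Finset.coe_union] at he
    rcases he with he | he
    · exact plainSet_verts hp hLm e he z hz
    · exact plainSet_verts hp hKm e he z hz
  have hS : ({z | z ∈ VQ → z = u ∨ z = v} : Set V) ∩ VQ ⊆ {u, v} := fun z hz => hz.1 hz.2
  -- step 0: `lev2C` as a configuration sum read on the matrices, level shifted by `2|V| + |L| + 2|K|`
  unfold lev2C
  rw [Finset.sum_congr rfl fun γ _ => show
      ((if apExpC (plainSet p L ∪ EQ) (plainSet p K ∪ CQ) γ = μ then
          F 0 (pat3 (γ ∪ (plainSet p K ∪ CQ)) x y s) (pat3 ((plainSet p L ∪ EQ) \ γ ∪ (plainSet p K ∪ CQ)) x y s) else 0) +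
        (if apExpC (plainSet p L ∪ EQ) (plainSet p K ∪ CQ) γ + 1 = μ then
          F 1 (pat3 (γ ∪ (plainSet p K ∪ CQ)) x y s) (pat3 ((plainSet p L ∪ EQ) \ γ ∪ (plainSet p K ∪ CQ)) x y s) else 0)) =
      (fun n A B => (if n = μ + 2 * Fintype.card V + (L.length + 2 * K.length) then F 0 (rdPat ix iy is A) (rdPat ix iy is B) else 0) +
        (if n + 1 = μ + 2 * Fintype.card V + (L.length + 2 * K.length) then F 1 (rdPat ix iy is A) (rdPat ix iy is B) else 0))
        (apExpC (plainSet p L ∪ EQ) (plainSet p K ∪ CQ) γ + 2 * Fintype.card V + (L.length + 2 * K.length))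
        (cmat p (γ ∪ (plainSet p K ∪ CQ))) (cmat p ((plainSet p L ∪ EQ) \ γ ∪ (plainSet p K ∪ CQ))) by
    simp only [rdPat, ← pat3_eq_ofBits_cmat p _ hx hy hs]
    rw [ite_eq_ite_of_iff (show apExpC (plainSet p L ∪ EQ) (plainSet p K ∪ CQ) γ = μ ↔
        apExpC (plainSet p L ∪ EQ) (plainSet p K ∪ CQ) γ + 2 * Fintype.card V + (L.length + 2 * K.length) =
          μ + 2 * Fintype.card V + (L.length + 2 * K.length) by omega) rfl,
      ite_eq_ite_of_iff (show apExpC (plainSet p L ∪ EQ) (plainSet p K ∪ CQ) γ + 1 = μ ↔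
        apExpC (plainSet p L ∪ EQ) (plainSet p K ∪ CQ) γ + 2 * Fintype.card V + (L.length + 2 * K.length) + 1 =
          μ + 2 * Fintype.card V + (L.length + 2 * K.length) by omega) rfl]]
  -- step 1: peel the piece (both sides minors)
  rw [sum_attachPatCC hdQ h₁ hQ hS huv hm hmu hmv hp hi hj hk (L.length + 2 * K.length) (fun n A B =>
      (if n = μ + 2 * Fintype.card V + (L.length + 2 * K.length) then F 0 (rdPat ix iy is A) (rdPat ix iy is B) else 0) +
        (if n + 1 = μ + 2 * Fintype.card V + (L.length + 2 * K.length) then F 1 (rdPat ix iy is A) (rdPat ix iy is B) else 0)),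
    Finset.sum_comm]
  refine Finset.sum_congr rfl fun γ hγ => ?_
  -- step 2: peel the skeleton (free and contracted) down to the edgeless host
  rw [Finset.sum_congr rfl fun γ₁ _ => show
      ((if apExpC (plainSet p L) (plainSet p K) γ₁ + apExpC EQ CQ γ +
            (if cmat p (γ₁ ∪ plainSet p K) i j && (pat3 (γ ∪ CQ) u v m).xy then 1 else 0) +
            (if cmat p (plainSet p L \ γ₁ ∪ plainSet p K) i j && (pat3 (EQ \ γ ∪ CQ) u v m).xy then 1 else 0) +
            (L.length + 2 * K.length) = μ + 2 * Fintype.card V + (L.length + 2 * K.length) then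
          F 0 (rdPat ix iy is (attachPat (cmat p (γ₁ ∪ plainSet p K)) i j k (pat3 (γ ∪ CQ) u v m)))
            (rdPat ix iy is (attachPat (cmat p (plainSet p L \ γ₁ ∪ plainSet p K)) i j k (pat3 (EQ \ γ ∪ CQ) u v m))) else 0) +
        (if apExpC (plainSet p L) (plainSet p K) γ₁ + apExpC EQ CQ γ +
            (if cmat p (γ₁ ∪ plainSet p K) i j && (pat3 (γ ∪ CQ) u v m).xy then 1 else 0) +
            (if cmat p (plainSet p L \ γ₁ ∪ plainSet p K) i j && (pat3 (EQ \ γ ∪ CQ) u v m).xy then 1 else 0) +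
            (L.length + 2 * K.length) + 1 = μ + 2 * Fintype.card V + (L.length + 2 * K.length) then
          F 1 (rdPat ix iy is (attachPat (cmat p (γ₁ ∪ plainSet p K)) i j k (pat3 (γ ∪ CQ) u v m)))
            (rdPat ix iy is (attachPat (cmat p (plainSet p L \ γ₁ ∪ plainSet p K)) i j k (pat3 (EQ \ γ ∪ CQ) u v m))) else 0)) =
      (fun n A B =>
        (if n + (if A i j && (pat3 (γ ∪ CQ) u v m).xy then 1 else 0) + (if B i j && (pat3 (EQ \ γ ∪ CQ) u v m).xy then 1 else 0) =
            μ + 2 * Fintype.card V + (L.length + 2 * K.length) then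
          F 0 (rdPat ix iy is (attachPat A i j k (pat3 (γ ∪ CQ) u v m))) (rdPat ix iy is (attachPat B i j k (pat3 (EQ \ γ ∪ CQ) u v m)))
          else 0) +
        (if n + (if A i j && (pat3 (γ ∪ CQ) u v m).xy then 1 else 0) + (if B i j && (pat3 (EQ \ γ ∪ CQ) u v m).xy then 1 else 0) + 1 =
            μ + 2 * Fintype.card V + (L.length + 2 * K.length) then
          F 1 (rdPat ix iy is (attachPat A i j k (pat3 (γ ∪ CQ) u v m))) (rdPat ix iy is (attachPat B i j k (pat3 (EQ \ γ ∪ CQ) u v m)))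
          else 0))
        (apExpC (plainSet p L) (plainSet p K) γ₁ + 2 * K.length + L.length + apExpC EQ CQ γ)
        (cmat p (γ₁ ∪ plainSet p K)) (cmat p (plainSet p L \ γ₁ ∪ plainSet p K)) by
    rw [ite_eq_ite_of_iff (show apExpC (plainSet p L) (plainSet p K) γ₁ + apExpC EQ CQ γ +
            (if cmat p (γ₁ ∪ plainSet p K) i j && (pat3 (γ ∪ CQ) u v m).xy then 1 else 0) +
            (if cmat p (plainSet p L \ γ₁ ∪ plainSet p K) i j && (pat3 (EQ \ γ ∪ CQ) u v m).xy then 1 else 0) +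
            (L.length + 2 * K.length) = μ + 2 * Fintype.card V + (L.length + 2 * K.length) ↔
          apExpC (plainSet p L) (plainSet p K) γ₁ + 2 * K.length + L.length + apExpC EQ CQ γ +
            (if cmat p (γ₁ ∪ plainSet p K) i j && (pat3 (γ ∪ CQ) u v m).xy then 1 else 0) +
            (if cmat p (plainSet p L \ γ₁ ∪ plainSet p K) i j && (pat3 (EQ \ γ ∪ CQ) u v m).xy then 1 else 0) =
            μ + 2 * Fintype.card V + (L.length + 2 * K.length) by omega) rfl,
      ite_eq_ite_of_iff (show apExpC (plainSet p L) (plainSet p K) γ₁ + apExpC EQ CQ γ +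
            (if cmat p (γ₁ ∪ plainSet p K) i j && (pat3 (γ ∪ CQ) u v m).xy then 1 else 0) +
            (if cmat p (plainSet p L \ γ₁ ∪ plainSet p K) i j && (pat3 (EQ \ γ ∪ CQ) u v m).xy then 1 else 0) +
            (L.length + 2 * K.length) + 1 = μ + 2 * Fintype.card V + (L.length + 2 * K.length) ↔
          apExpC (plainSet p L) (plainSet p K) γ₁ + 2 * K.length + L.length + apExpC EQ CQ γ +
            (if cmat p (γ₁ ∪ plainSet p K) i j && (pat3 (γ ∪ CQ) u v m).xy then 1 else 0) +
            (if cmat p (plainSet p L \ γ₁ ∪ plainSet p K) i j && (pat3 (EQ \ γ ∪ CQ) u v m).xy then 1 else 0) + 1 =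
            μ + 2 * Fintype.card V + (L.length + 2 * K.length) by omega) rfl],
    sum_plainListK_empty hinj L K hL hnd (apExpC EQ CQ γ) (fun n A B =>
        (if n + (if A i j && (pat3 (γ ∪ CQ) u v m).xy then 1 else 0) + (if B i j && (pat3 (EQ \ γ ∪ CQ) u v m).xy then 1 else 0) =
            μ + 2 * Fintype.card V + (L.length + 2 * K.length) then
          F 0 (rdPat ix iy is (attachPat A i j k (pat3 (γ ∪ CQ) u v m))) (rdPat ix iy is (attachPat B i j k (pat3 (EQ \ γ ∪ CQ) u v m)))
          else 0) +
        (if n + (if A i j && (pat3 (γ ∪ CQ) u v m).xy then 1 else 0) + (if B i j && (pat3 (EQ \ γ ∪ CQ) u v m).xy then 1 else 0) + 1 =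
            μ + 2 * Fintype.card V + (L.length + 2 * K.length) then
          F 1 (rdPat ix iy is (attachPat A i j k (pat3 (γ ∪ CQ) u v m))) (rdPat ix iy is (attachPat B i j k (pat3 (EQ \ γ ∪ CQ) u v m)))
          else 0))]
  -- step 3: the summands agree (the `2|V|` cancels)
  congr 1
  funext bs
  unfold shape1TermK skelPatK skelCorrK
  rw [ite_eq_ite_of_iff (show 2 * Fintype.card V + (foldBits (idMat ι) (zipBits L bs)).2 +
          (foldBits (idMat ι) (zipBits L (bs.map (! ·)))).2 +
          ((foldBits (foldBits (idMat ι) (zipBits L bs)).1 (trueBits K)).2 +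
            (foldBits (foldBits (idMat ι) (zipBits L (bs.map (! ·)))).1 (trueBits K)).2) + apExpC EQ CQ γ +
          (if (foldBits (foldBits (idMat ι) (zipBits L bs)).1 (trueBits K)).1 i j && (pat3 (γ ∪ CQ) u v m).xy then 1 else 0) +
          (if (foldBits (foldBits (idMat ι) (zipBits L (bs.map (! ·)))).1 (trueBits K)).1 i j && (pat3 (EQ \ γ ∪ CQ) u v m).xy
            then 1 else 0) = μ + 2 * Fintype.card V + (L.length + 2 * K.length) ↔
        apExpC EQ CQ γ + ((foldBits (idMat ι) (zipBits L bs)).2 +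
          (foldBits (foldBits (idMat ι) (zipBits L bs)).1 (trueBits K)).2 +
          (if (foldBits (foldBits (idMat ι) (zipBits L bs)).1 (trueBits K)).1 i j && (pat3 (γ ∪ CQ) u v m).xy then 1 else 0) +
          ((foldBits (idMat ι) (zipBits L (bs.map (! ·)))).2 +
            (foldBits (foldBits (idMat ι) (zipBits L (bs.map (! ·)))).1 (trueBits K)).2 +
            (if (foldBits (foldBits (idMat ι) (zipBits L (bs.map (! ·)))).1 (trueBits K)).1 i j &&
              (pat3 (EQ \ γ ∪ CQ) u v m).xy then 1 else 0))) = μ + L.length + 2 * K.length by omega) rfl,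
    ite_eq_ite_of_iff (show 2 * Fintype.card V + (foldBits (idMat ι) (zipBits L bs)).2 +
          (foldBits (idMat ι) (zipBits L (bs.map (! ·)))).2 +
          ((foldBits (foldBits (idMat ι) (zipBits L bs)).1 (trueBits K)).2 +
            (foldBits (foldBits (idMat ι) (zipBits L (bs.map (! ·)))).1 (trueBits K)).2) + apExpC EQ CQ γ +
          (if (foldBits (foldBits (idMat ι) (zipBits L bs)).1 (trueBits K)).1 i j && (pat3 (γ ∪ CQ) u v m).xy then 1 else 0) +
          (if (foldBits (foldBits (idMat ι) (zipBits L (bs.map (! ·)))).1 (trueBits K)).1 i j && (pat3 (EQ \ γ ∪ CQ) u v m).xy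
            then 1 else 0) + 1 = μ + 2 * Fintype.card V + (L.length + 2 * K.length) ↔
        apExpC EQ CQ γ + ((foldBits (idMat ι) (zipBits L bs)).2 +
          (foldBits (foldBits (idMat ι) (zipBits L bs)).1 (trueBits K)).2 +
          (if (foldBits (foldBits (idMat ι) (zipBits L bs)).1 (trueBits K)).1 i j && (pat3 (γ ∪ CQ) u v m).xy then 1 else 0) +
          ((foldBits (idMat ι) (zipBits L (bs.map (! ·)))).2 +
            (foldBits (foldBits (idMat ι) (zipBits L (bs.map (! ·)))).1 (trueBits K)).2 +
            (if (foldBits (foldBits (idMat ι) (zipBits L (bs.map (! ·)))).1 (trueBits K)).1 i j &&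
              (pat3 (EQ \ γ ∪ CQ) u v m).xy then 1 else 0))) + 1 = μ + L.length + 2 * K.length by omega) rfl]

end ContractedSkeleton

end FK

end Summit.CriticalPhenomena.PercolationContinuityZ3.Theorems
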